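import Summits.Schanuel.Schanuel.Theorems.RigidCoreSparsityTwoOfAtoms
import Summits.Schanuel.Schanuel.Theorems.RigidCoreSparsityTwoBakerDepthCap
import Literature.NumberTheory.Transcendental.PiTranscendenceMeasureMain

/-!
# Line `cusp-germ-schneider-sparsity` — skeleton v10 for crux `RigidCore.SparsityTwo`
(item stmt-Schanuel-0971, route route-Schanuel-RigidCore; lead prover-line-stmt-Schanuel-0971-c4-0, gen c4, 2026-08-16)

`SparsityTwo_of : Summit.Schanuel.Schanuel.Theses.RigidCore.SparsityTwo` is the landed glue `sparsityTwo_of_namedAtoms`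
(`Theorems/RigidCoreSparsityTwoOfAtoms.lean`, p116239) applied to the three NAMED atoms of
`Theorems/RigidCoreSparsityTwoDefs.lean` (p115838 + p122920).  v10 = v9 (lead c3) + the c4 pockets for the one atom
that had NO depth cap, A3 (`WildCuspAtom`): a NEW arithmetic input, the Nesterenko–Waldschmidt 1996 transcendence
measure of `π` (`Literature.NumberTheory.Transcendental.NesterenkoWaldschmidt1996_thm_2_2_holds`, PROVED in the tree):
at a cusp whose σ-jet has rational structure in `π` — a π-MONOMIAL `q (2π)^{j/e} n^{m/e} + q₀` (the sub-linear /
pure-power torsion class of Disproof §3a, root chain: `e = 3`, `A = −(2π)^{-2/3} w − 1/2`) or a rational LAURENT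
POLYNOMIAL IN `π` times powers of `n` (the `e = 1` torsion class of Disproof §3b, double-Cayley cubic: jet in `ℚ[π²][n]`) —
an exact hit makes a NON-ZERO INTEGER POLYNOMIAL of bounded degree and height `n^{O(1)}` take the value
`O(|g(σ_n)|) = O(n^{-(K+1)/e})` at `π`, against `|P(π)| ≥ L(P)^{-κ(d)}`; so the tail depth is capped:
`stub_wildPiMonomialDepthCapRay`, `stub_wildPiPolynomialDepthCapRay` (ray forms, W-free, registered, delegated) with
their `CuspDatum` forms `wildCusp_piMonomial_depthCap` / `wildCusp_piPolynomial_depthCap` proved here, and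
`stub_wildCuspAtom` DERIVED from them and the shallow residual `stub_wildCuspAtomShallow` (registered, OPEN).

Sorried here: `stub_wildPiMonomialDepthCapRay`, `stub_wildPiPolynomialDepthCapRay` (provable, in flight),
`stub_wildCuspAtomShallow` (A3 residual, OPEN), `stub_inhomogeneousCuspAtomShallow` (A2 residual below its Baker cap,
OPEN), `stub_linearCuspAtom` (A1, OPEN).  Scale table of the residual atoms (what an exact hit is measured against):
A1 — Roth/Dirichlet (`j ≤ e`, nothing below); A2 — Baker 1975 Thm 3.1 (`j ≤ K_Baker`); A3 at a torsion cusp with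
rational π-structure — NW1996 (`ord g ≤ K_π`); A3 otherwise (algebraic Puiseux data / non-torsion cusp values) — none
(would need norm bookkeeping over the Puiseux field, resp. an algebraic-independence measure for `π` and `log α`).
The residual atoms are open exact-coincidence problems (polynomial-coefficient / ramified Shapiro), each SC(2)-implied
(`namedAtoms_of_schanuelRank_two`).  History v1–v9: git history of this path and `Cruxes/SparsityTwo/NOTES.md`.
-/

set_option linter.dupNamespace false

namespace Summit.Schanuel.Schanuel.Cruxes.SparsityTwo.CuspGermSchneiderSparsity

open Filter Topology Complex Polynomial Literature.NumberTheory.Transcendental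
open scoped Real

/-! ## c4 pockets: depth caps for wild jets with rational π-structure (transcendence measure of π) -/

/-- **Pocket (ray form, registered stub; c4): π-MONOMIAL wild jets carry a finite depth cap.**  For `e ≥ 1`, `m ≥ 1`,
`j ≠ 0`, `q ≠ 0`: there is `K` such that every tail `g` analytic at `0` and flat to order `K` there has only finitely
many `n` with `q (2π)^{j/e} n^{m/e} + q₀ + g(n^{-1/e}) ∈ ℤ`.  Proof route: at a hit raise `q(2π)^{j/e} n^{m/e} = Z/D − g`
to the `e`-th power — an integer polynomial of degree `|j|`, height `O(n^m)`, NON-ZERO, takes a value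
`O(n^{m(e−1)/e} |g(σ_n)|)` at `π`; `NesterenkoWaldschmidt1996_thm_2_2_holds` bounds it below by `n^{-mκ(|j|)}`. -/
theorem stub_wildPiMonomialDepthCapRay :
    ∀ (e m : ℕ) (j : ℤ) (q q₀ : ℚ), 0 < e → 0 < m → q ≠ 0 → j ≠ 0 →
      ∃ K : ℕ, ∀ g : ℂ → ℂ, AnalyticAt ℂ g 0 →
        (∀ i : ℕ, i ≤ K → iteratedDeriv i g 0 = 0) →
        Set.Finite {n : ℕ | ∃ L : ℤ,
          (q : ℂ) * (((2 * Real.pi) ^ ((j : ℝ) / (e : ℝ)) : ℝ) : ℂ) * (rayAbscissa e n) ^ m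
            + (q₀ : ℂ) + g (rayAbscissa e n)⁻¹ = L} := by
  sorry

/-- **Pocket (ray form, registered stub; c4): jets in `ℚ[π, π⁻¹][n]` carry a finite depth cap.**  The coefficient of
`n^m` (`m ≤ N`) is the rational Laurent polynomial `∑_{|i| ≤ M} c m i · π^i`, and some coefficient with `i ≠ 0` is
non-zero (the jet genuinely involves `π`; `i = 0` alone is the Runge case).  Then there is `K` such that every tail
`g` analytic at `0` and flat to order `K` has finitely many `n` with `∑ c m i π^i n^m + g(n^{-1/e}) ∈ ℤ`.  Proof route:
`π^M · D · (jet − L)` is an integer polynomial in `π` of degree `≤ 2M`, height `O(n^N)`, non-zero for all large `n`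
(its `X^{M+i}`-coefficient is a non-zero rational polynomial in `n`), of size `O(|g(σ_n)|)`; NW1996 Thm 2(2). -/
theorem stub_wildPiPolynomialDepthCapRay :
    ∀ (e M N : ℕ) (c : ℕ → ℤ → ℚ), 0 < e →
      (∃ m : ℕ, ∃ i : ℤ, m ≤ N ∧ i ≠ 0 ∧ -(M : ℤ) ≤ i ∧ i ≤ M ∧ c m i ≠ 0) →
      ∃ K : ℕ, ∀ g : ℂ → ℂ, AnalyticAt ℂ g 0 →
        (∀ i : ℕ, i ≤ K → iteratedDeriv i g 0 = 0) →
        Set.Finite {n : ℕ | ∃ L : ℤ,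
          (∑ m ∈ Finset.range (N + 1), ∑ i ∈ Finset.Icc (-(M : ℤ)) M,
              (c m i : ℂ) * (Real.pi : ℂ) ^ i * (n : ℂ) ^ m) + g (rayAbscissa e n)⁻¹ = L} := by
  sorry

/-- **CuspDatum form of the π-monomial cap**: a cusp datum whose σ-jet is `q (2π)^{j/e} X^m + q₀` and whose tail is flat
to the class's order `K` has finitely many independent hits (`indepHits ⊆ hits`, then the ray pocket). -/
theorem wildCusp_piMonomial_depthCap :
    ∀ (e m : ℕ) (j : ℤ) (q q₀ : ℚ), 0 < e → 0 < m → q ≠ 0 → j ≠ 0 →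
      ∃ K : ℕ, ∀ D : CuspDatum, D.e = e →
        D.A = Polynomial.C ((q : ℂ) * (((2 * Real.pi) ^ ((j : ℝ) / (e : ℝ)) : ℝ) : ℂ)) * Polynomial.X ^ m
                + Polynomial.C (q₀ : ℂ) →
        (∀ i : ℕ, i ≤ K → iteratedDeriv i D.g 0 = 0) → D.indepHits.Finite := by
  intro e m j q q₀ he hm hq hj
  obtain ⟨K, hK⟩ := stub_wildPiMonomialDepthCapRay e m j q q₀ he hm hq hj
  refine ⟨K, fun D hDe hA hflat => (hK D.g D.g_analytic hflat).subset ?_⟩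
  rintro n ⟨-, L, hL⟩
  refine ⟨L, ?_⟩
  rw [← hL, hA, hDe]
  simp [Polynomial.eval_add, Polynomial.eval_mul, Polynomial.eval_pow, Polynomial.eval_C, Polynomial.eval_X]

/-- **CuspDatum form of the π-polynomial cap**: a cusp datum whose σ-jet, as a function of `n`, is
`∑_{m ≤ N} (∑_{|i| ≤ M} c m i π^i) n^m` with some `c m i ≠ 0`, `i ≠ 0`, and whose tail is flat to the class's order `K`,
has finitely many independent hits. -/
theorem wildCusp_piPolynomial_depthCap :
    ∀ (e M N : ℕ) (c : ℕ → ℤ → ℚ), 0 < e →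
      (∃ m : ℕ, ∃ i : ℤ, m ≤ N ∧ i ≠ 0 ∧ -(M : ℤ) ≤ i ∧ i ≤ M ∧ c m i ≠ 0) →
      ∃ K : ℕ, ∀ D : CuspDatum, D.e = e →
        (∀ n : ℕ, D.A.eval (rayAbscissa D.e n) =
          ∑ m ∈ Finset.range (N + 1), ∑ i ∈ Finset.Icc (-(M : ℤ)) M,
            (c m i : ℂ) * (Real.pi : ℂ) ^ i * (n : ℂ) ^ m) →
        (∀ i : ℕ, i ≤ K → iteratedDeriv i D.g 0 = 0) → D.indepHits.Finite := by
  intro e M N c he hne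
  obtain ⟨K, hK⟩ := stub_wildPiPolynomialDepthCapRay e M N c he hne
  refine ⟨K, fun D hDe hA hflat => (hK D.g D.g_analytic hflat).subset ?_⟩
  rintro n ⟨-, L, hL⟩
  refine ⟨L, ?_⟩
  rw [← hL, hA n, hDe]

/-! ## The atoms -/

/-- **A3 residual — wild cusp atom below every π-cap** (OPEN; registered stub `stub_wildCuspAtomShallow`, c4
reshape).  The data of `WildCuspAtom`, and in addition: for every π-monomial presentation of the σ-jet with a valid
depth cap `K` (valid = flatness to order `K` forces finiteness throughout that jet class) the tail is `K`-SHALLOW,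
and likewise for every π-polynomial presentation.  By `wildCusp_piMonomial_depthCap` / `wildCusp_piPolynomial_depthCap`
such caps exist, so the deep rational-π-structure data are no longer in the atom; what is left is every other wild
datum (algebraic non-rational Puiseux data, non-torsion cusp values) and the shallow rational ones (Disproof §3a/§3b
themselves: depth `1`). -/
theorem stub_wildCuspAtomShallow :
    ∀ D : CuspDatum,
      (¬ ∃ (β : ℂ) (G : ℂ → ℂ), AnalyticAt ℂ G 0 ∧ D.IsLinearJet β G) →
      ¬ D.IsLocallyConstantExp →
      (∀ (m : ℕ) (j : ℤ) (q q₀ : ℚ) (K : ℕ), 0 < m → q ≠ 0 → j ≠ 0 →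
        D.A = Polynomial.C ((q : ℂ) * (((2 * Real.pi) ^ ((j : ℝ) / (D.e : ℝ)) : ℝ) : ℂ)) * Polynomial.X ^ m
                + Polynomial.C (q₀ : ℂ) →
        (∀ D' : CuspDatum, D'.e = D.e →
          D'.A = Polynomial.C ((q : ℂ) * (((2 * Real.pi) ^ ((j : ℝ) / (D.e : ℝ)) : ℝ) : ℂ)) * Polynomial.X ^ m
                  + Polynomial.C (q₀ : ℂ) →
          (∀ i : ℕ, i ≤ K → iteratedDeriv i D'.g 0 = 0) → D'.indepHits.Finite) →
        ∃ i : ℕ, i ≤ K ∧ iteratedDeriv i D.g 0 ≠ 0) →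
      (∀ (M N : ℕ) (c : ℕ → ℤ → ℚ) (K : ℕ),
        (∃ m : ℕ, ∃ i : ℤ, m ≤ N ∧ i ≠ 0 ∧ -(M : ℤ) ≤ i ∧ i ≤ M ∧ c m i ≠ 0) →
        (∀ n : ℕ, D.A.eval (rayAbscissa D.e n) =
          ∑ m ∈ Finset.range (N + 1), ∑ i ∈ Finset.Icc (-(M : ℤ)) M,
            (c m i : ℂ) * (Real.pi : ℂ) ^ i * (n : ℂ) ^ m) →
        (∀ D' : CuspDatum, D'.e = D.e →
          (∀ n : ℕ, D'.A.eval (rayAbscissa D'.e n) =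
            ∑ m ∈ Finset.range (N + 1), ∑ i ∈ Finset.Icc (-(M : ℤ)) M,
              (c m i : ℂ) * (Real.pi : ℂ) ^ i * (n : ℂ) ^ m) →
          (∀ i : ℕ, i ≤ K → iteratedDeriv i D'.g 0 = 0) → D'.indepHits.Finite) →
        ∃ i : ℕ, i ≤ K ∧ iteratedDeriv i D.g 0 ≠ 0) →
      D.indepHits.Finite := by
  sorry

/-- **A3 — wild cusp atom** (registered stub `stub_wildCuspAtom : WildCuspAtom`), DERIVED (c4): a datum in a
rational-π-structure class that is flat to that class's cap is finite by the landed-route pockets; every other datum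
is the shallow residual `stub_wildCuspAtomShallow`. -/
theorem stub_wildCuspAtom : WildCuspAtom := by
  intro D hnl hnc
  classical
  by_cases h₁ : ∃ (m : ℕ) (j : ℤ) (q q₀ : ℚ) (K : ℕ), 0 < m ∧ q ≠ 0 ∧ j ≠ 0 ∧
      D.A = Polynomial.C ((q : ℂ) * (((2 * Real.pi) ^ ((j : ℝ) / (D.e : ℝ)) : ℝ) : ℂ)) * Polynomial.X ^ m
              + Polynomial.C (q₀ : ℂ) ∧
      (∀ D' : CuspDatum, D'.e = D.e →
        D'.A = Polynomial.C ((q : ℂ) * (((2 * Real.pi) ^ ((j : ℝ) / (D.e : ℝ)) : ℝ) : ℂ)) * Polynomial.X ^ m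
                + Polynomial.C (q₀ : ℂ) →
        (∀ i : ℕ, i ≤ K → iteratedDeriv i D'.g 0 = 0) → D'.indepHits.Finite) ∧
      (∀ i : ℕ, i ≤ K → iteratedDeriv i D.g 0 = 0)
  · obtain ⟨m, j, q, q₀, K, -, -, -, hA, hcap, hflat⟩ := h₁
    exact hcap D rfl hA hflat
  by_cases h₂ : ∃ (M N : ℕ) (c : ℕ → ℤ → ℚ) (K : ℕ),
      (∃ m : ℕ, ∃ i : ℤ, m ≤ N ∧ i ≠ 0 ∧ -(M : ℤ) ≤ i ∧ i ≤ M ∧ c m i ≠ 0) ∧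
      (∀ n : ℕ, D.A.eval (rayAbscissa D.e n) =
        ∑ m ∈ Finset.range (N + 1), ∑ i ∈ Finset.Icc (-(M : ℤ)) M,
          (c m i : ℂ) * (Real.pi : ℂ) ^ i * (n : ℂ) ^ m) ∧
      (∀ D' : CuspDatum, D'.e = D.e →
        (∀ n : ℕ, D'.A.eval (rayAbscissa D'.e n) =
          ∑ m ∈ Finset.range (N + 1), ∑ i ∈ Finset.Icc (-(M : ℤ)) M,
            (c m i : ℂ) * (Real.pi : ℂ) ^ i * (n : ℂ) ^ m) →
        (∀ i : ℕ, i ≤ K → iteratedDeriv i D'.g 0 = 0) → D'.indepHits.Finite) ∧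
      (∀ i : ℕ, i ≤ K → iteratedDeriv i D.g 0 = 0)
  · obtain ⟨M, N, c, K, -, hA, hcap, hflat⟩ := h₂
    exact hcap D rfl hA hflat
  refine stub_wildCuspAtomShallow D hnl hnc ?_ ?_
  · intro m j q q₀ K hm hq hj hA hcap
    by_contra hsh
    push Not at hsh
    exact h₁ ⟨m, j, q, q₀, K, hm, hq, hj, hA, hcap, hsh⟩
  · intro M N c K hne hA hcap
    by_contra hsh
    push Not at hsh
    exact h₂ ⟨M, N, c, K, hne, hA, hcap, hsh⟩

/-- Sanity (c4): the cap hypotheses of the residual are INHABITED — every π-monomial class has a valid cap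
(so `stub_wildCuspAtomShallow` genuinely excludes the deep data of that class). -/
theorem exists_piMonomial_cap (D : CuspDatum) (m : ℕ) (j : ℤ) (q q₀ : ℚ) (hm : 0 < m) (hq : q ≠ 0) (hj : j ≠ 0) :
    ∃ K : ℕ, ∀ D' : CuspDatum, D'.e = D.e →
      D'.A = Polynomial.C ((q : ℂ) * (((2 * Real.pi) ^ ((j : ℝ) / (D.e : ℝ)) : ℝ) : ℂ)) * Polynomial.X ^ m
              + Polynomial.C (q₀ : ℂ) →
      (∀ i : ℕ, i ≤ K → iteratedDeriv i D'.g 0 = 0) → D'.indepHits.Finite :=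
  wildCusp_piMonomial_depthCap D.e m j q q₀ D.e_pos hm hq hj

/-- Sanity (c4): every π-polynomial class has a valid cap. -/
theorem exists_piPolynomial_cap (D : CuspDatum) (M N : ℕ) (c : ℕ → ℤ → ℚ)
    (hne : ∃ m : ℕ, ∃ i : ℤ, m ≤ N ∧ i ≠ 0 ∧ -(M : ℤ) ≤ i ∧ i ≤ M ∧ c m i ≠ 0) :
    ∃ K : ℕ, ∀ D' : CuspDatum, D'.e = D.e →
      (∀ n : ℕ, D'.A.eval (rayAbscissa D'.e n) =
        ∑ m ∈ Finset.range (N + 1), ∑ i ∈ Finset.Icc (-(M : ℤ)) M,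
          (c m i : ℂ) * (Real.pi : ℂ) ^ i * (n : ℂ) ^ m) →
      (∀ i : ℕ, i ≤ K → iteratedDeriv i D'.g 0 = 0) → D'.indepHits.Finite :=
  wildCusp_piPolynomial_depthCap D.e M N c D.e_pos hne

/-- **A2 at BAKER-BOUNDED depth — the open residual of the inhomogeneous linear cusp atom** (OPEN; registered
stub `stub_inhomogeneousCuspAtomShallow : InhomogeneousCuspAtomShallow`, `RigidCoreSparsityTwoDefs` p122920, lead c3). -/
theorem stub_inhomogeneousCuspAtomShallow : InhomogeneousCuspAtomShallow := by
  sorry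

/-- **A2 — inhomogeneous linear cusp atom** (registered stub `stub_inhomogeneousCuspAtom : InhomogeneousCuspAtom`),
DERIVED (c3): the Baker depth cap `linearCusp_bakerDepthCap` (LANDED) settles the flat case; the rest is the shallow
residual `stub_inhomogeneousCuspAtomShallow`. -/
theorem stub_inhomogeneousCuspAtom : InhomogeneousCuspAtom := by
  intro D G β hG hlin hβ hGalg hirr hnc htor
  obtain ⟨K, hK⟩ := linearCusp_bakerDepthCap D G β hG hlin hβ hGalg hirr
  by_cases hflat : ∀ j : ℕ, 1 ≤ j → j ≤ K → iteratedDeriv j (D.defectGerm β G) 0 = 0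
  · exact hK hflat
  · push Not at hflat
    obtain ⟨j, hj1, hjK, hj⟩ := hflat
    exact stub_inhomogeneousCuspAtomShallow D G β K hG hlin hβ hGalg hirr hnc htor hK ⟨j, hj1, hjK, hj⟩

/-- **A1 — torsion-homogeneous linear cusp atom at or below the Dirichlet scale** (OPEN; registered stub). -/
theorem stub_linearCuspAtom : LinearCuspAtom := by
  sorry

/-- **Skeleton theorem**: the crux `RigidCore.SparsityTwo` BY NAME, modulo exactly the sorried stubs above (landed
glue `sparsityTwo_of_namedAtoms`, `RigidCoreSparsityTwoOfAtoms` p116239). -/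
theorem SparsityTwo_of : Summit.Schanuel.Schanuel.Theses.RigidCore.SparsityTwo :=
  sparsityTwo_of_namedAtoms stub_wildCuspAtom stub_inhomogeneousCuspAtom stub_linearCuspAtom

end Summit.Schanuel.Schanuel.Cruxes.SparsityTwo.CuspGermSchneiderSparsity
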